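import Summits.ResolutionOfSingularities.ResolutionOfSingularities.Theorems.FrobeniusLadderFRationalResolutionFixedPointKatoIdeal
import HarnessLib

/-!
# Crux `FrobeniusLadder.FRationalResolution` (stmt-ResolutionOfSingularities-15317), line `redirect`,
# stub `stub_diagonalizableQuotientResolution` — near a FIXED point the chart ring is generated over
# `S₀` by the homogeneous parameters, UNIFORMLY on an invariant neighbourhood (step (c) of the
# Kato-(7.1)-at-fixed-points plan, memo MEMO-15317-leafhand2-g3 §6)

`…FixedPointAdjoin` gives `S_𝔔 = (S₀)_𝔮[t]` at a fixed prime `𝔔` (torsion grading, `t ⊆ 𝔔` a finite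
homogeneous set generating `𝔪_{S_𝔔}`). This file clears the denominators: POINTWISE, every `s ∈ S`
has a degree-zero multiple `u s ∈ S₀[t]` with `u ∉ 𝔔`; and, `S` being a FINITE `S₀`-module
(integral of finite type), ONE degree-zero `g ∉ 𝔔` works for all `s` — i.e. `S_g = (S₀)_g[t]` on the
invariant neighbourhood `D(g)`, which is the hypothesis `hgen` of `…GradedMonomials` needed at the
primes NEAR `𝔮`.

* `exists_gradeZero_mul_mem_adjoin_of_fixed` — `∀ s, ∃ u ∈ S₀ ∖ 𝔮, u s ∈ S₀[t]`;
* **`exists_gradeZero_forall_mul_mem_adjoin_of_fixed`** — `∃ g ∈ S₀ ∖ 𝔮, ∀ s, g s ∈ S₀[t]`.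

Honest label: elementary brick (no stub closed). No definitions, no named facts, no sorry.
[folklore; cite: Matsumura1987, Thm. 8.4, Thm. 9.4] [cite: SGA3, Exp. VIII §4–5]
-/

noncomputable section

-- single-problem summit: the doubled namespace component is forced
set_option linter.dupNamespace false

open DirectSum IsLocalRing
open Literature.AlgebraicGeometry.Resolution.DiagonalizableQuotient
open Literature.RingTheory.GradedAlgebra

namespace Summit.ResolutionOfSingularities.ResolutionOfSingularities.Theorems.FRationalResolution.FixedPointMonomialNhd

universe u w

variable {k : Type u} [Field k] {A : Type w} [DecidableEq A] [AddCommGroup A] {S : Type u}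
  [CommRing S] [Algebra k S] (𝒮 : A → Submodule k S) [GradedAlgebra 𝒮]

/-- **Pointwise denominators**: at a fixed prime `𝔔` (torsion grading, `t ⊆ 𝔔` finite homogeneous
generating `𝔪_{S_𝔔}`), every `s ∈ S` satisfies `u • s ∈ S₀[t]` for some degree-zero `u ∉ 𝔔`
(from `S_𝔔 = (S₀)_𝔮[t]`, `…FixedPointAdjoin.adjoin_eq_top_atPrime_of_fixed`, by clearing the
denominators of an `(S₀)_𝔮`-combination of monomials). [folklore; cite: Matsumura1987, Thm. 8.4] -/
theorem exists_gradeZero_mul_mem_adjoin_of_fixed [IsNoetherianRing S] [Algebra.FiniteType k S]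
    (hA : AddMonoid.IsTorsion A) (𝔔 : Ideal S) [𝔔.IsPrime]
    (hfix : ∀ a : A, a ≠ 0 → ∀ s ∈ 𝒮 a, s ∈ 𝔔) (t : Finset S)
    (htspan : Ideal.span (algebraMap S (Localization.AtPrime 𝔔) '' (↑t : Set S)) =
      maximalIdeal (Localization.AtPrime 𝔔)) (s : S) :
    ∃ u : 𝒮 0, (u : S) ∉ 𝔔 ∧ (u : S) * s ∈ Algebra.adjoin (𝒮 0) (↑t : Set S) := by
  classical
  set 𝔮 : Ideal (𝒮 0) := 𝔔.comap (algebraMap (𝒮 0) S) with h𝔮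
  set T : Submonoid S := 𝔮.primeCompl.map (algebraMap (𝒮 0) S) with hTdef
  have hT : ∀ s ∈ T, s ∈ 𝒮 0 := by
    rintro _ ⟨u, -, rfl⟩
    exact u.2
  let L := Localization T
  haveI : IsLocalRing L := FixedPointLocal.isLocalRing_localization_of_fixed 𝒮 hA 𝔔 hfix L
  haveI : IsLocalization.AtPrime L 𝔔 :=
    FixedPointLocal.isLocalization_atPrime_of_fixed 𝒮 hA 𝔔 hfix L
  let ℒ := locPiece 𝒮 T hT L
  letI : GradedAlgebra ℒ := (nonempty_gradedAlgebra_locPiece 𝒮 T hT L).some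
  letI := locPieceZeroAlgebra 𝒮 T hT L
  have hloc := isLocalization_locPiece_zero 𝒮 T hT L
  rw [Submonoid.comap_map_eq_of_injective (algebraMap_gradeZero_injective 𝒮)] at hloc
  haveI : IsLocalization.AtPrime (ℒ 0) 𝔮 := hloc
  haveI : IsScalarTower (𝒮 0) (ℒ 0) L := IsScalarTower.of_algebraMap_eq fun a => rfl
  -- `L = L₀[t]`
  have hspanL : Ideal.span (algebraMap S L '' (↑t : Set S)) = maximalIdeal L :=
    FixedPointKatoIdeal.span_image_eq_maximalIdeal_of_atPrime 𝔔 t htspan L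
  have hgen : Algebra.adjoin (ℒ 0) (algebraMap S L '' (↑t : Set S)) = ⊤ :=
    FixedPointAdjoin.adjoin_eq_top_atPrime_of_fixed 𝒮 hA 𝔔 hfix (ℒ 0) L t hspanL
  set M : Submonoid S := Submonoid.closure (↑t : Set S) with hM
  have hcl : Submonoid.closure (algebraMap S L '' (↑t : Set S)) =
      M.map (algebraMap S L : S →* L) := by
    rw [hM, MonoidHom.map_mclosure]; rfl
  have hs : algebraMap S L s ∈ Submodule.span (ℒ 0)
      ((M.map (algebraMap S L : S →* L) : Submonoid L) : Set L) := by
    have h := Algebra.adjoin_eq_span (R := ℒ 0) (algebraMap S L '' (↑t : Set S))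
    rw [hgen, Algebra.top_toSubmodule, hcl] at h
    rw [← h]
    exact Submodule.mem_top
  haveI h𝔮p : 𝔮.IsPrime := by rw [h𝔮]; infer_instance
  have hone : (1 : 𝒮 0) ∉ 𝔮 := fun h => h𝔮p.ne_top ((Ideal.eq_top_iff_one _).mpr h)
  have halgL : ∀ a : 𝒮 0, ((algebraMap (𝒮 0) (ℒ 0) a : ℒ 0) : L) = algebraMap S L a :=
    fun a => rfl
  -- clear denominators along the span
  have key : ∀ y ∈ Submodule.span (ℒ 0) ((M.map (algebraMap S L : S →* L) : Submonoid L) : Set L),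
      ∃ u : 𝒮 0, u ∉ 𝔮 ∧ ∃ b ∈ Submodule.span (𝒮 0) (M : Set S),
        algebraMap S L (u : S) * y = algebraMap S L b := by
    intro y hy
    induction hy using Submodule.span_induction with
    | mem z hz =>
      obtain ⟨μ, hμ, rfl⟩ := Submonoid.mem_map.mp hz
      refine ⟨1, hone, μ, Submodule.subset_span hμ, ?_⟩
      rw [SetLike.GradeZero.coe_one, map_one, one_mul]
      rfl
    | zero => exact ⟨1, hone, 0, Submodule.zero_mem _, by rw [mul_zero, map_zero]⟩
    | add y z _ _ hy hz =>
      obtain ⟨u₁, hu₁, b₁, hb₁, h₁⟩ := hy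
      obtain ⟨u₂, hu₂, b₂, hb₂, h₂⟩ := hz
      refine ⟨u₁ * u₂, fun h => (h𝔮p.mem_or_mem h).elim hu₁ hu₂,
        u₂ • b₁ + u₁ • b₂, Submodule.add_mem _ (Submodule.smul_mem _ _ hb₁)
          (Submodule.smul_mem _ _ hb₂), ?_⟩
      rw [SetLike.GradeZero.coe_mul, map_mul, mul_add, map_add, Algebra.smul_def, Algebra.smul_def,
        map_mul, map_mul, ← h₁, ← h₂]
      change _ = algebraMap S L (u₂ : S) * _ + algebraMap S L (u₁ : S) * _
      ring
    | smul ℓ y _ hy =>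
      obtain ⟨u, hu, b, hb, h⟩ := hy
      -- `ℓ = c / v`
      obtain ⟨⟨c, v⟩, hcv⟩ := IsLocalization.surj 𝔮.primeCompl ℓ
      refine ⟨u * (v : 𝒮 0), fun h' => (h𝔮p.mem_or_mem h').elim hu v.2, c • b,
        Submodule.smul_mem _ _ hb, ?_⟩
      have hℓv : (ℓ : L) * algebraMap S L ((v : 𝒮 0) : S) = algebraMap S L (c : S) := by
        have h1 := congrArg (fun z : ℒ 0 => (z : L)) hcv
        simp only [SetLike.GradeZero.coe_mul, halgL] at h1
        exact h1
      rw [Algebra.smul_def, show algebraMap (ℒ 0) L ℓ = (ℓ : L) from rfl, SetLike.GradeZero.coe_mul,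
        map_mul, Algebra.smul_def, map_mul, show algebraMap (𝒮 0) S c = (c : S) from rfl]
      calc algebraMap S L ↑u * algebraMap S L ↑(↑v : 𝒮 0) * (↑ℓ * y)
          = (↑ℓ * algebraMap S L ↑(↑v : 𝒮 0)) * (algebraMap S L ↑u * y) := by ring
        _ = algebraMap S L ↑c * algebraMap S L b := by rw [hℓv, h]
  obtain ⟨u, hu, b, hb, hub⟩ := key _ hs
  rw [← map_mul] at hub
  obtain ⟨⟨_, ⟨v, hv, rfl⟩⟩, hvub⟩ := (IsLocalization.eq_iff_exists T L).mp hub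
  refine ⟨v * u, fun h => (h𝔮p.mem_or_mem h).elim hv hu, ?_⟩
  have hbmem : b ∈ Algebra.adjoin (𝒮 0) (↑t : Set S) := by
    have h := Algebra.adjoin_eq_span (R := 𝒮 0) (↑t : Set S)
    rw [← hM] at h
    change b ∈ Subalgebra.toSubmodule (Algebra.adjoin (𝒮 0) (↑t : Set S))
    rw [h]; exact hb
  have heq : ((v * u : 𝒮 0) : S) * s = (v : 𝒮 0) • b := by
    rw [Algebra.smul_def, show algebraMap (𝒮 0) S v = (v : S) from rfl, SetLike.GradeZero.coe_mul,
      mul_assoc]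
    exact hvub
  rw [heq]
  exact Subalgebra.smul_mem _ hbmem _

/-- **One denominator for all** (step (c)): under the same hypotheses, if `S` is of finite type over
`k` (so a FINITE `S₀`-module, being integral over `S₀`), there is a degree-zero `g ∉ 𝔔` with
`g • s ∈ S₀[t]` for EVERY `s ∈ S`; i.e. `S_g = (S₀)_g[t]` on the invariant neighbourhood `D(g)`.
[folklore; cite: Matsumura1987, Thm. 9.4] -/
theorem exists_gradeZero_forall_mul_mem_adjoin_of_fixed [IsNoetherianRing S] [Algebra.FiniteType k S]
    (hA : AddMonoid.IsTorsion A) (𝔔 : Ideal S) [𝔔.IsPrime]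
    (hfix : ∀ a : A, a ≠ 0 → ∀ s ∈ 𝒮 a, s ∈ 𝔔) (t : Finset S)
    (htspan : Ideal.span (algebraMap S (Localization.AtPrime 𝔔) '' (↑t : Set S)) =
      maximalIdeal (Localization.AtPrime 𝔔)) :
    ∃ g : 𝒮 0, (g : S) ∉ 𝔔 ∧ ∀ s : S, (g : S) * s ∈ Algebra.adjoin (𝒮 0) (↑t : Set S) := by
  classical
  haveI : Module.Finite (𝒮 0) S := module_finite_gradeZero 𝒮 hA
  obtain ⟨gens, hgens⟩ := Module.finite_def.mp ‹Module.Finite (𝒮 0) S›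
  choose u hu hmem using fun s : S =>
    exists_gradeZero_mul_mem_adjoin_of_fixed 𝒮 hA 𝔔 hfix t htspan s
  have halg : ∀ r : 𝒮 0, algebraMap (𝒮 0) S r = (r : S) := fun r => rfl
  have hcoe : ∀ c : Finset S, ((∏ s ∈ c, u s : 𝒮 0) : S) = ∏ s ∈ c, (u s : S) := fun c => by
    induction c using Finset.induction_on with
    | empty => simp
    | insert a c ha ih => rw [Finset.prod_insert ha, Finset.prod_insert ha, SetLike.GradeZero.coe_mul, ih]
  refine ⟨∏ s ∈ gens, u s, ?_, fun s => ?_⟩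
  · intro h
    rw [hcoe] at h
    obtain ⟨s, -, hs⟩ := (Ideal.IsPrime.prod_mem_iff (p := 𝔔)).mp h
    exact hu s hs
  · -- write `s` over the generators and use `u_{s'} s' ∈ S₀[t]`
    have hs : s ∈ Submodule.span (𝒮 0) (↑gens : Set S) := by rw [hgens]; exact Submodule.mem_top
    set B := Algebra.adjoin (𝒮 0) (↑t : Set S) with hB
    have key : ∀ y ∈ Submodule.span (𝒮 0) (↑gens : Set S),
        ((∏ s ∈ gens, u s : 𝒮 0) : S) * y ∈ B := by
      intro y hy
      induction hy using Submodule.span_induction with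
      | mem z hz =>
        have hsplit : (∏ s ∈ gens, u s) = u z * ∏ x ∈ gens.erase z, u x :=
          (Finset.mul_prod_erase gens u hz).symm
        have heq : ((∏ s ∈ gens, u s : 𝒮 0) : S) * z =
            (∏ x ∈ gens.erase z, u x : 𝒮 0) • ((u z : S) * z) := by
          rw [Algebra.smul_def, halg, hsplit, ← halg, map_mul, halg, halg]
          ring
        rw [heq]
        exact Subalgebra.smul_mem _ (hmem z) _
      | zero => rw [mul_zero]; exact Subalgebra.zero_mem _
      | add y z _ _ hy hz => rw [mul_add]; exact Subalgebra.add_mem _ hy hz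
      | smul r y _ hy =>
        rw [Algebra.smul_def, mul_left_comm]
        exact Subalgebra.mul_mem _ (Subalgebra.algebraMap_mem _ r) hy
    exact key s hs

end Summit.ResolutionOfSingularities.ResolutionOfSingularities.Theorems.FRationalResolution.FixedPointMonomialNhd

end
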